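import Mathlib
import HarnessLib
import HarnessLib.Audit
import Summits.Langlands.Langlands.Theorems.DepthIsolationSplit
import Literature.NumberTheory.Automorphic.SolvableBaseChangeModularityProofs
import Literature.NumberTheory.Automorphic.TotallyRealModularity
import Literature.NumberTheory.Automorphic.RealQuadraticJInvariantModularity
import Literature.NumberTheory.EllipticCurves.IsogenyHasCMProofs
import Summits.Langlands.Langlands.Theorems.JDegreeFilterSplitPrelude

/-!
# JDegreeFilterSplit (Bridge) — lens-5 g27 node on REST_E = `DepthIsolationSplit.UnanchoredHighDegreeModularE`
Census-twin landing of the node file `HOME/nodes/lens-5-g27-JDegreeFilterSplit.lean` (sha256 19b9e9133f31…, 780 l), SPLIT VERBATIM into three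
Theorems files for the gate's 400-line lint (census-1 g30; crit-1 g9 CLEARED row 401), with gate repairs limited to docstrings: nine one-line
docstrings added on previously undocumented lemmas; the kit's three unregistered cite keys re-keyed to registered bib keys (Dieulefait2015,
BCDT2001, DieulefaitFreitas2014) and every citation written as a prose `[ref: KEY, locator]` tag (NOT a gate cite-tag, so that the node-local
junction defs stay in this file instead of entering the Literature relocation lane — the cell's census-twin convention); no declaration body changed.  Prelude = §1–§4 (dial, sectors, RJD, NSBC with the `jModel` section) · Bridge = §4 tail,
§4b, §4b′, §4c · main = §5–§7 (compositions `closes_target` / `closes_byName`, orbit closure, guards).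
This part covers §4 (tail), §4b, §4b′, §4c.  The full module docstring of the node is kept in the Prelude.
-/

set_option linter.dupNamespace false
set_option linter.unusedVariables false

open scoped NumberField IntermediateField
open NumberField Literature.NumberTheory.Automorphic
open Summit.Langlands.Langlands.Theorems.DepthIsolationSplit (UnanchoredBox UnanchoredHighDegreeModularE
  modularE_iff_box IntegralModelTransferPointwise SatakeAvatarTwo satakeAvatarTwo_of_host)

namespace Summit.Langlands.Langlands.Theorems.JDegreeFilterSplit

/-- The sector mechanism over an ABSTRACT small field `F → K`: if every integral curve over `F` is automorphic of
weight zero (`hmod`, print: FLS / DNS) and weight-zero automorphy base-changes from `F` into `K` (`hBC`, the leaf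
NSBC), then every integral `E / 𝓞 K` with `j(E) ∈ F` is modular (CM, or twist of the base change of the
`F`-model `jModel p q` of the same `j`).  Template: `isModularEllipticCurve_of_jInvariant_eq_algebraMap_of_finrank_eq_two`. -/
theorem isModularEllipticCurve_of_jInv_eq_algebraMap
    (F : Type) [Field F] [NumberField F] (K : Type) [Field K] [NumberField K] [IsTotallyReal K] [Algebra F K]
    (hmod : ∀ E₀ : WeierstrassCurve (𝓞 F), E₀.Δ ≠ 0 → IsAutomorphicOfWeightZero E₀)
    (hBC : ∀ E₀ : WeierstrassCurve (𝓞 F), E₀.Δ ≠ 0 → IsAutomorphicOfWeightZero E₀ →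
      IsModularEllipticCurve K (E₀.baseChange (𝓞 K)))
    (E : WeierstrassCurve (𝓞 K)) (hΔ : E.Δ ≠ 0) (j₀ : F) (hj : jInv K E = algebraMap F K j₀) :
    IsModularEllipticCurve K E := by
  classical
  by_cases h01 : j₀ = 0 ∨ j₀ = 1728
  · haveI hW : (E.baseChange K).IsElliptic := isElliptic_baseChange_of_Δ_ne_zero hΔ
    have hjE : (E.baseChange K).j = algebraMap F K j₀ := (j_baseChange_eq_c₄_pow_div hΔ).trans hj
    refine Or.inl (WeierstrassCurve.HasCM.of_j_eq_zero_or_1728 ?_)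
    rcases h01 with h | h
    · exact Or.inl (by rw [hjE, h, map_zero])
    · exact Or.inr (by rw [hjE, h, map_ofNat])
  push Not at h01
  obtain ⟨hj0, hj1728⟩ := h01
  obtain ⟨p, q, hqnz, hpq⟩ := IsFractionRing.div_surjective (A := 𝓞 F) j₀
  have hq : q ≠ 0 := nonZeroDivisors.ne_zero hqnz
  have hqF : algebraMap (𝓞 F) F q ≠ 0 := (map_ne_zero_iff _ (FaithfulSMul.algebraMap_injective (𝓞 F) F)).2 hq
  have hp : p ≠ 0 := by
    rintro rfl
    apply hj0
    rw [← hpq, map_zero, zero_div]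
  have hp1728 : p ≠ 1728 * q := by
    intro h
    apply hj1728
    rw [← hpq, h, map_mul, map_ofNat, mul_div_assoc, div_self hqF, mul_one]
  have hΔ₀ : (jModel p q).Δ ≠ 0 := jModel_Δ_ne_zero hp hq hp1728
  have hmodK : IsModularEllipticCurve K ((jModel p q).baseChange (𝓞 K)) :=
    hBC (jModel p q) hΔ₀ (hmod (jModel p q) hΔ₀)
  have hjF : (algebraMap (𝓞 F) F (jModel p q).c₄) ^ 3 / algebraMap (𝓞 F) F (jModel p q).Δ = j₀ := by
    have hΔF : algebraMap (𝓞 F) F (jModel p q).Δ ≠ 0 :=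
      (map_ne_zero_iff _ (FaithfulSMul.algebraMap_injective (𝓞 F) F)).2 hΔ₀
    rw [div_eq_iff hΔF, ← hpq, div_mul_eq_mul_div, eq_div_iff hqF, ← map_pow, ← map_mul, ← map_mul,
      jModel_c₄_pow_three_mul p q, mul_comm]
  have hj' : jInv K ((jModel p q).baseChange (𝓞 K)) = algebraMap F K j₀ := by
    rw [jInv_baseChange, hjF]
  have hΔ₀K : ((jModel p q).baseChange (𝓞 K)).Δ ≠ 0 := baseChange_Δ_ne_zero F K _ hΔ₀
  have hj0K : algebraMap F K j₀ ≠ 0 := (map_ne_zero_iff _ (algebraMap F K).injective).2 hj0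
  have hj1728K : algebraMap F K j₀ ≠ 1728 := by
    intro h
    apply hj1728
    apply (algebraMap F K).injective
    rw [h, map_ofNat]
  refine isModularEllipticCurve_of_jInvariant_eq_holds K ((jModel p q).baseChange (𝓞 K)) E hΔ₀K hΔ
    (hj'.trans hj.symm) ?_ ?_ hmodK
  · exact fun h0 => hj0K (hj'.symm.trans h0)
  · exact fun h0 => hj1728K (hj'.symm.trans h0)

/-- PRINT over the field of moduli in the bridge range: every integral curve over `ℚ(j) ≤ K₀` is automorphic of weight zero
(FLS Thm 1 in degree 2, DNS Thm 4 in degree 3, Box Thm 1.1 in degree 4 without `√5` — tree facts BY NAME). -/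
theorem automorphic_over_moduliField (hFLS : FLS2015_theorem1) (hDNS : DNS2020_theorem4) (hBox : Box2022_theorem1_1)
    (K₀ : Type) [Field K₀] [NumberField K₀] [IsTotallyReal K₀] (E : WeierstrassCurve (𝓞 K₀))
    (hr : InBridgeRange K₀ E) :
    ∀ E₀ : WeierstrassCurve (𝓞 ℚ⟮jInv K₀ E⟯), E₀.Δ ≠ 0 → IsAutomorphicOfWeightZero E₀ := by
  intro E₀ hΔ₀
  obtain ⟨h2, h34 | ⟨h4, h5⟩⟩ := hr
  · rcases Nat.lt_or_ge (jDeg K₀ E) 3 with hlt | hge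
    · exact hFLS _ (by unfold jDeg at h2 hlt; omega) E₀ hΔ₀
    · exact hDNS _ (by unfold jDeg at h34 hge; omega) E₀ hΔ₀
  · exact hBox _ h4 h5 E₀ hΔ₀

/-- In the bridge range the field of moduli has degree at least `2`. -/
theorem InBridgeRange.two_le {K₀ : Type} [Field K₀] [NumberField K₀] {E : WeierstrassCurve (𝓞 K₀)}
    (hr : InBridgeRange K₀ E) : 2 ≤ Module.finrank ℚ ℚ⟮jInv K₀ E⟯ := hr.1

/-- In the bridge range the field of moduli has degree at most `4`. -/
theorem InBridgeRange.le_four {K₀ : Type} [Field K₀] [NumberField K₀] {E : WeierstrassCurve (𝓞 K₀)}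
    (hr : InBridgeRange K₀ E) : Module.finrank ℚ ℚ⟮jInv K₀ E⟯ ≤ 4 := by
  have := hr.2; unfold jDeg at this; omega

/-- KERNEL: NSBC ∧ FLS2015_theorem1 ∧ DNS2020_theorem4 ∧ Box2022_theorem1_1 ⇒ SJD.  The field of moduli `F = ℚ⟮j(E)⟯ ≤ K₀` is a totally
real number field of degree `jDeg ∈ {2, 3, 4}` (without `√5` in degree 4); every integral curve over it is automorphic of
weight zero (FLS Thm 1 / DNS Thm 4 / Box Thm 1.1, BY NAME); NSBC carries the automorphy of the `F`-model of `j(E)` into `K₀`; twist invariance and CM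
finish. -/
theorem smallFieldJDoor_of_bridge (hBC : SmallFieldBaseChange) (hFLS : FLS2015_theorem1)
    (hDNS : DNS2020_theorem4) (hBox : Box2022_theorem1_1) : SmallFieldJDoor := by
  intro K₀ _ _ hbox E hΔ hr
  haveI : IsTotallyReal K₀ := hbox.1
  have hbc : ∀ E₀ : WeierstrassCurve (𝓞 ℚ⟮jInv K₀ E⟯), E₀.Δ ≠ 0 → IsAutomorphicOfWeightZero E₀ →
      IsModularEllipticCurve K₀ (E₀.baseChange (𝓞 K₀)) :=
    fun E₀ hΔ₀ haut => hBC K₀ hbox ℚ⟮jInv K₀ E⟯ hr.two_le hr.le_four E₀ hΔ₀ haut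
  exact isModularEllipticCurve_of_jInv_eq_algebraMap ℚ⟮jInv K₀ E⟯ K₀
    (automorphic_over_moduliField hFLS hDNS hBox K₀ E hr) hbc E hΔ
    ⟨jInv K₀ E, IntermediateField.mem_adjoin_simple_self ℚ _⟩ rfl

/-! ## §4b Inside the bridge sector: soluble cover (PRINT) versus insoluble cover (IDEA-NEEDED) -/

/-- `K₀` embeds over `F` into a totally real number field `M`, finite Galois over `F` with SOLVABLE group (i.e. the
relative Galois closure of `K₀ / F` is solvable — automatic when `[K₀ : F] ≤ 4`, so for every box field of degree
`6 ≤ d ≤ 9` over its quadratic / cubic subfields; the first insoluble instances are `d = 10`, `[K₀ : F] = 5` with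
closure `A₅`/`S₅` over a real quadratic `F`). -/
def EmbedsInSolvableCover (F K₀ : Type) [Field F] [Field K₀] [Algebra F K₀] : Prop :=
  ∃ (M : Type) (_ : Field M) (_ : NumberField M) (_ : Algebra F M) (_ : Algebra K₀ M),
    IsScalarTower F K₀ M ∧ IsTotallyReal M ∧ IsGalois F M ∧ IsSolvable (M ≃ₐ[F] M)

/-- SJD_sol (PRINT modulo DESC): the bridge sector on the curves whose base field is SOLUBLY covered over the field of
moduli `ℚ(j)`. -/
def SmallFieldJDoorSoluble : Prop :=
  ∀ (K₀ : Type) [Field K₀] [NumberField K₀], UnanchoredBox K₀ →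
    ∀ E : WeierstrassCurve (𝓞 K₀), E.Δ ≠ 0 → InBridgeRange K₀ E →
      EmbedsInSolvableCover ℚ⟮jInv K₀ E⟯ K₀ → IsModularEllipticCurve K₀ E

/-- SJD_ins (IDEA-NEEDED; void in degrees `6 ≤ d ≤ 9`): the bridge sector on the curves whose base field is NOT solubly
covered over `ℚ(j)` — insoluble base change of Hilbert newforms over a real quadratic / totally real cubic field. -/
def SmallFieldJDoorInsoluble : Prop :=
  ∀ (K₀ : Type) [Field K₀] [NumberField K₀], UnanchoredBox K₀ →
    ∀ E : WeierstrassCurve (𝓞 K₀), E.Δ ≠ 0 → InBridgeRange K₀ E →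
      ¬ EmbedsInSolvableCover ℚ⟮jInv K₀ E⟯ K₀ → IsModularEllipticCurve K₀ E

/-- EXACTNESS of the inner cut (excluded middle on the cover predicate). -/
theorem smallFieldJDoor_iff_cover_split :
    SmallFieldJDoor ↔ SmallFieldJDoorSoluble ∧ SmallFieldJDoorInsoluble := by
  refine ⟨fun h => ⟨fun K₀ _ _ hb E hΔ hr _ => h K₀ hb E hΔ hr,
    fun K₀ _ _ hb E hΔ hr _ => h K₀ hb E hΔ hr⟩, ?_⟩
  rintro ⟨hs, hi⟩ K₀ _ _ hb E hΔ hr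
  by_cases hc : EmbedsInSolvableCover ℚ⟮jInv K₀ E⟯ K₀
  · exact hs K₀ hb E hΔ hr hc
  · exact hi K₀ hb E hΔ hr hc

/-- DESC (PRINT junction): SOLVABLE DESCENT of modularity for elliptic curves — if `M / K₀` is a finite Galois totally
real extension with solvable group and `E ⊗ 𝓞 M` is modular over `M`, then `E` is modular over `K₀` (cyclic descent of
prime degree, Langlands 1980, iterated along a composition series; `ρ_E|G_M` stays irreducible for non-CM `E` since
`M` is totally real; CM curves are the cone's first alternative).  [ref: Langlands1980AMS96, Ch. 2]
[ref: Thorne2016, Lemma 7.1 (the ascent half)] -/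
def SolvableDescentModularity : Prop :=
  ∀ (K₀ : Type) [Field K₀] [NumberField K₀] [IsTotallyReal K₀] (M : Type) [Field M] [NumberField M]
    [IsTotallyReal M] [Algebra K₀ M] [IsGalois K₀ M] [IsSolvable (M ≃ₐ[K₀] M)]
    (E : WeierstrassCurve (𝓞 K₀)), E.Δ ≠ 0 →
      IsModularEllipticCurve M (E.baseChange (𝓞 M)) → IsModularEllipticCurve K₀ E

/-- Restriction of scalars `Gal(M/K₀) → Gal(M/F)` along `F → K₀ → M`, an injective group hom. [folklore] -/
def galRestrictScalarsHom (F K₀ M : Type) [Field F] [Field K₀] [Field M] [Algebra F K₀] [Algebra F M]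
    [Algebra K₀ M] [IsScalarTower F K₀ M] : (M ≃ₐ[K₀] M) →* (M ≃ₐ[F] M) where
  toFun := AlgEquiv.restrictScalars F
  map_one' := by ext; rfl
  map_mul' := fun _ _ => by ext; rfl

/-- Restriction of scalars `Gal(M/K₀) → Gal(M/F)` along a tower `F → K₀ → M` is injective. -/
theorem galRestrictScalarsHom_injective (F K₀ M : Type) [Field F] [Field K₀] [Field M] [Algebra F K₀]
    [Algebra F M] [Algebra K₀ M] [IsScalarTower F K₀ M] :
    Function.Injective (galRestrictScalarsHom F K₀ M) :=
  AlgEquiv.restrictScalars_injective F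

/-- KERNEL: the SOLUBLE part of the bridge sector is PRINT — Thorne's soluble base change (tree fact BY NAME) from the
field of moduli up to the cover `M`, FLS / DNS over the field of moduli, twist invariance over `M`, and DESC down to
`K₀`. -/
theorem smallFieldJDoorSoluble_of_print
    (hBC : isModularEllipticCurve_baseChange_of_isSolvable_of_isAutomorphicOfWeightZero)
    (hD : SolvableDescentModularity) (hFLS : FLS2015_theorem1) (hDNS : DNS2020_theorem4)
    (hBox : Box2022_theorem1_1) : SmallFieldJDoorSoluble := by
  intro K₀ _ _ hbox E hΔ hr hcov
  obtain ⟨M, _i1, _i2, _i3, _i4, htower, hTR, hgal, hsol⟩ := hcov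
  haveI : IsTotallyReal K₀ := hbox.1
  haveI := htower
  haveI := hTR
  haveI := hgal
  haveI := hsol
  haveI : IsGalois K₀ M := IsGalois.tower_top_of_isGalois ℚ⟮jInv K₀ E⟯ K₀ M
  haveI : IsSolvable (M ≃ₐ[K₀] M) :=
    solvable_of_solvable_injective (galRestrictScalarsHom_injective ℚ⟮jInv K₀ E⟯ K₀ M)
  have hmod := automorphic_over_moduliField hFLS hDNS hBox K₀ E hr
  have hbcM : ∀ E₀ : WeierstrassCurve (𝓞 ℚ⟮jInv K₀ E⟯), E₀.Δ ≠ 0 → IsAutomorphicOfWeightZero E₀ →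
      IsModularEllipticCurve M (E₀.baseChange (𝓞 M)) :=
    fun E₀ hΔ₀ haut => hBC ℚ⟮jInv K₀ E⟯ M E₀ hΔ₀ haut
  have hj : jInv M (E.baseChange (𝓞 M)) =
      algebraMap ℚ⟮jInv K₀ E⟯ M ⟨jInv K₀ E, IntermediateField.mem_adjoin_simple_self ℚ _⟩ := by
    rw [jInv_baseChange, IsScalarTower.algebraMap_apply ℚ⟮jInv K₀ E⟯ K₀ M]
    rfl
  have hM : IsModularEllipticCurve M (E.baseChange (𝓞 M)) :=
    isModularEllipticCurve_of_jInv_eq_algebraMap ℚ⟮jInv K₀ E⟯ M hmod hbcM (E.baseChange (𝓞 M))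
      (baseChange_Δ_ne_zero K₀ M E hΔ) _ hj
  exact hD K₀ M E hΔ hM

/-- Hence SJD ⟸ (Thorne soluble base change, DESC, FLS, DNS: all PRINT) ∧ SJD_ins: inside the bridge sector only the
INSOLUBLY covered curves are idea-needed. -/
theorem smallFieldJDoor_of_print_and_insoluble
    (hBC : isModularEllipticCurve_baseChange_of_isSolvable_of_isAutomorphicOfWeightZero)
    (hD : SolvableDescentModularity) (hFLS : FLS2015_theorem1) (hDNS : DNS2020_theorem4)
    (hBox : Box2022_theorem1_1) (hI : SmallFieldJDoorInsoluble) : SmallFieldJDoor :=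
  smallFieldJDoor_iff_cover_split.2 ⟨smallFieldJDoorSoluble_of_print hBC hD hFLS hDNS hBox, hI⟩

/-- NSBC ⇒ SJD_ins (the leaf NSBC covers the insoluble part; FLS / DNS supply the automorphy over `ℚ(j)`). -/
theorem smallFieldJDoorInsoluble_of_bridge (hBC : SmallFieldBaseChange) (hFLS : FLS2015_theorem1)
    (hDNS : DNS2020_theorem4) (hBox : Box2022_theorem1_1) : SmallFieldJDoorInsoluble :=
  fun K₀ _ _ hb E hΔ hr _ => smallFieldJDoor_of_bridge hBC hFLS hDNS hBox K₀ hb E hΔ hr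

/-! ## §4b′ The same cut on the ℚ-door: its solubly covered part is PRINT by name (tree fact + DESC) -/

/-- RJD_sol: curves with rational `j` over box fields `K₀` that embed in a totally real SOLVABLE Galois extension `M/ℚ`
(e.g. every box field whose Galois closure is solvable) are modular.  PRINT: the tree fact
`isModularEllipticCurve_baseChange_rat_of_isSolvable` over `M`, twist invariance over `M`, DESC down to `K₀`
(`rationalJDoorSoluble_of_print`). -/
def RationalJDoorSoluble : Prop :=
  ∀ (K₀ : Type) [Field K₀] [NumberField K₀], UnanchoredBox K₀ →
    ∀ E : WeierstrassCurve (𝓞 K₀), E.Δ ≠ 0 → jDeg K₀ E ≤ 1 → EmbedsInSolvableCover ℚ K₀ → IsModularEllipticCurve K₀ E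

/-- RJD_ins: curves with rational `j` over box fields with INSOLUBLE Galois closure (first instances: sextics with closure
`A₆`, `S₆`, `PGL₂(5)`, …) are modular.  PRINT-mod-DBC only (Dieulefait 2012 Thm 1.2: base change of classical newforms to ANY
totally real field); no solvable-tower substitute. -/
def RationalJDoorInsoluble : Prop :=
  ∀ (K₀ : Type) [Field K₀] [NumberField K₀], UnanchoredBox K₀ →
    ∀ E : WeierstrassCurve (𝓞 K₀), E.Δ ≠ 0 → jDeg K₀ E ≤ 1 → ¬ EmbedsInSolvableCover ℚ K₀ → IsModularEllipticCurve K₀ E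

/-- EXACTNESS of the cut of the ℚ-door. -/
theorem rationalJDoor_iff_cover_split : RationalJDoor ↔ RationalJDoorSoluble ∧ RationalJDoorInsoluble := by
  refine ⟨fun h => ⟨fun K₀ _ _ hb E hΔ hd _ => h K₀ hb E hΔ hd, fun K₀ _ _ hb E hΔ hd _ => h K₀ hb E hΔ hd⟩, ?_⟩
  rintro ⟨hs, hi⟩ K₀ _ _ hb E hΔ hd
  by_cases hc : EmbedsInSolvableCover ℚ K₀
  · exact hs K₀ hb E hΔ hd hc
  · exact hi K₀ hb E hΔ hd hc

/-- KERNEL: RJD_sol is PRINT by name modulo DESC. -/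
theorem rationalJDoorSoluble_of_print (hBC : isModularEllipticCurve_baseChange_rat_of_isSolvable)
    (hD : SolvableDescentModularity) : RationalJDoorSoluble := by
  intro K₀ _ _ hbox E hΔ hdeg hcov
  obtain ⟨M, _i1, _i2, _i3, _i4, htower, hTR, hgal, hsol⟩ := hcov
  obtain rfl : _i3 = DivisionRing.toRatAlgebra := Subsingleton.elim _ _
  haveI : IsTotallyReal K₀ := hbox.1
  haveI := htower
  haveI := hTR
  haveI := hgal
  haveI := hsol
  haveI : IsGalois K₀ M := IsGalois.tower_top_of_isGalois ℚ K₀ M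
  haveI : IsSolvable (M ≃ₐ[K₀] M) :=
    solvable_of_solvable_injective (galRestrictScalarsHom_injective ℚ K₀ M)
  obtain ⟨j₀, hj₀⟩ := exists_ratCast_eq_of_jDeg_le_one K₀ E hdeg
  have hjM : jInv M (E.baseChange (𝓞 M)) = (j₀ : M) := by
    rw [jInv_baseChange]
    show algebraMap K₀ M (jInv K₀ E) = _
    rw [← hj₀, map_ratCast]
  have hM : IsModularEllipticCurve M (E.baseChange (𝓞 M)) :=
    isModularEllipticCurve_of_jInv_eq_ratCast_pointwise M (fun E₀ h => hBC M E₀ h) (E.baseChange (𝓞 M))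
      (baseChange_Δ_ne_zero K₀ M E hΔ) j₀ hjM
  exact hD K₀ M E hΔ hM

/-- Hence RJD ⟸ (tree fact, DESC: PRINT) ∧ RJD_ins, and DBC is needed only on insolubly-closed box fields. -/
theorem rationalJDoor_of_print_and_insoluble (hBC : isModularEllipticCurve_baseChange_rat_of_isSolvable)
    (hD : SolvableDescentModularity) (hI : RationalJDoorInsoluble) : RationalJDoor :=
  rationalJDoor_iff_cover_split.2 ⟨rationalJDoorSoluble_of_print hBC hD, hI⟩

/-- The insolubly covered part of the ℚ-door follows from the base-change junction DBC (same argument as `rationalJDoor_of_ratBaseChange`). -/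
theorem rationalJDoorInsoluble_of_ratBaseChange (hBC : RatBaseChangeModularity) : RationalJDoorInsoluble :=
  fun K₀ _ _ hb E hΔ hd _ => rationalJDoor_of_ratBaseChange hBC K₀ hb E hΔ hd

/-! ## §4c Inside the insoluble part: Galois covers of a real quadratic field of moduli are PRINT (Dieulefait–Freitas) -/

/-- QGBC (PRINT junction; not yet vendored): BASE CHANGE OF ELLIPTIC CURVES OVER REAL QUADRATIC FIELDS TO GALOIS TOTALLY REAL
EXTENSIONS — «Let `E` be an elliptic curve over a real quadratic field `K`. Let also `F/K` be a totally real finite Galois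
extension. Then `E/F` is modular.» (Dieulefait–Freitas 2014, Theorem 3; ANY Galois group, insoluble included: non-solvable
residual images stay non-solvable (Prop. 2.1) and FLS's `3·5·7` theorem applies over `F`; big solvable images by a Sylow base
change (§3.1) plus Langlands' solvable base change; the finitely many exceptional curves `𝓔_K` by Cor. 4.1.)  Rendered on the
tree's carrier exactly like `FLS2015_theorem1`.  [ref: DieulefaitFreitas2014, Thm 3 (arXiv:1402.6232 = C. R. Math. Acad. Sci. Paris 353 (2015) 1–4, doi:10.1016/j.crma.2014.10.006)] -/
def QuadraticGaloisBaseChange : Prop :=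
  ∀ (F : Type) [Field F] [NumberField F] [IsTotallyReal F], Module.finrank ℚ F = 2 →
    ∀ (K : Type) [Field K] [NumberField K] [IsTotallyReal K] [Algebra F K] [IsGalois F K]
      (E₀ : WeierstrassCurve (𝓞 F)), E₀.Δ ≠ 0 → IsModularEllipticCurve K (E₀.baseChange (𝓞 K))

/-- SJD₂^gal (PRINT modulo QGBC): the bridge sector on the curves with `[ℚ(j):ℚ] = 2` whose base field is GALOIS over the
field of moduli `ℚ(j)` (insoluble groups included). -/
def QuadraticGaloisJDoor : Prop :=
  ∀ (K₀ : Type) [Field K₀] [NumberField K₀], UnanchoredBox K₀ →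
    ∀ E : WeierstrassCurve (𝓞 K₀), E.Δ ≠ 0 → jDeg K₀ E = 2 → IsGalois ℚ⟮jInv K₀ E⟯ K₀ →
      IsModularEllipticCurve K₀ E

/-- KERNEL: QGBC ∧ FLS2015_theorem1 ⇒ SJD₂^gal (the `ℚ(j)`-model of `j(E)` is modular over `ℚ(j)` by FLS, over `K₀` by
Dieulefait–Freitas, and `E` is its twist or CM). -/
theorem quadraticGaloisJDoor_of_print (h : QuadraticGaloisBaseChange) (hFLS : FLS2015_theorem1) :
    QuadraticGaloisJDoor := by
  intro K₀ _ _ hbox E hΔ h2 hgal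
  haveI : IsTotallyReal K₀ := hbox.1
  haveI := hgal
  have hF : Module.finrank ℚ ℚ⟮jInv K₀ E⟯ = 2 := h2
  exact isModularEllipticCurve_of_jInv_eq_algebraMap ℚ⟮jInv K₀ E⟯ K₀ (fun E₀ hΔ₀ => hFLS _ hF E₀ hΔ₀)
    (fun E₀ hΔ₀ _ => h _ hF K₀ E₀ hΔ₀) E hΔ ⟨jInv K₀ E, IntermediateField.mem_adjoin_simple_self ℚ _⟩ rfl

/-- SJD_hard (the RESIDUAL OF THE BRIDGE SECTOR after print: IDEA-NEEDED): the curves in the bridge range (`[ℚ(j):ℚ] ∈ {2, 3}`,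
or `4` without `√5`) over box fields `K₀` that are NEITHER solubly covered over `ℚ(j)` NOR (when `[ℚ(j):ℚ] = 2`) Galois over
`ℚ(j)` — concretely `[K₀ : ℚ(j)] ≥ 5` with insoluble relative Galois closure, `K₀/ℚ(j)` non-Galois if `ℚ(j)` is quadratic (first
instances: degree `d = 10`, a non-Galois quintic cover of a real quadratic field with closure `A₅`/`S₅`; `d = 15` over a cubic
field; `d = 20` over a quartic field).  Inside it, curves whose
mod-`p` image is non-solvable for some `p ∈ {3,5,7}` are still PRINT (FLS's `3·5·7` theorem over `K₀` + Dieulefait–Freitas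
Prop. 2.1); the kernel of difficulty is: insolubly covered `K₀` × curves over `ℚ(j)` with solvable images at `3, 5, 7`. -/
def SmallFieldJDoorHard : Prop :=
  ∀ (K₀ : Type) [Field K₀] [NumberField K₀], UnanchoredBox K₀ →
    ∀ E : WeierstrassCurve (𝓞 K₀), E.Δ ≠ 0 → InBridgeRange K₀ E →
      ¬ EmbedsInSolvableCover ℚ⟮jInv K₀ E⟯ K₀ → ¬ (jDeg K₀ E = 2 ∧ IsGalois ℚ⟮jInv K₀ E⟯ K₀) →
        IsModularEllipticCurve K₀ E

/-- EXACTNESS of the fine cut of the bridge sector: SJD ⟺ SJD_sol ∧ SJD₂^gal ∧ SJD_hard. -/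
theorem smallFieldJDoor_iff_fine_split :
    SmallFieldJDoor ↔ SmallFieldJDoorSoluble ∧ QuadraticGaloisJDoor ∧ SmallFieldJDoorHard := by
  refine ⟨fun h => ⟨fun K₀ _ _ hb E hΔ hr _ => h K₀ hb E hΔ hr,
    fun K₀ _ _ hb E hΔ h2 _ => h K₀ hb E hΔ ⟨by omega, Or.inl (by omega)⟩,
    fun K₀ _ _ hb E hΔ hr _ _ => h K₀ hb E hΔ hr⟩, ?_⟩
  rintro ⟨hs, hg, hh⟩ K₀ _ _ hb E hΔ hr
  by_cases hc : EmbedsInSolvableCover ℚ⟮jInv K₀ E⟯ K₀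
  · exact hs K₀ hb E hΔ hr hc
  by_cases hq : jDeg K₀ E = 2 ∧ IsGalois ℚ⟮jInv K₀ E⟯ K₀
  · exact hg K₀ hb E hΔ hq.1 hq.2
  · exact hh K₀ hb E hΔ hr hc hq

/-- SJD_ins ⟺ SJD₂^gal-off-covers ∧ SJD_hard; in particular QGJD ∧ SJD_hard ⇒ SJD_ins and SJD_ins ⇒ SJD_hard. -/
theorem smallFieldJDoorInsoluble_of_quadGalois_and_hard (hg : QuadraticGaloisJDoor) (hh : SmallFieldJDoorHard) :
    SmallFieldJDoorInsoluble := by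
  intro K₀ _ _ hb E hΔ hr hc
  by_cases hq : jDeg K₀ E = 2 ∧ IsGalois ℚ⟮jInv K₀ E⟯ K₀
  · exact hg K₀ hb E hΔ hq.1 hq.2
  · exact hh K₀ hb E hΔ hr hc hq

/-- The hard residue SJD_hard of the bridge is a restriction of its insoluble part SJD_ins. -/
theorem smallFieldJDoorHard_of_insoluble (hi : SmallFieldJDoorInsoluble) : SmallFieldJDoorHard :=
  fun K₀ _ _ hb E hΔ hr hc _ => hi K₀ hb E hΔ hr hc

/-- NECESSITY: REST_E ⇒ QGBC restricted to box fields (a Galois base change into the box is an integral curve there). -/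
theorem quadraticGaloisBaseChange_onBox_of_restE (h : UnanchoredHighDegreeModularE)
    (F : Type) [Field F] [NumberField F] [IsTotallyReal F] (hF : Module.finrank ℚ F = 2)
    (K : Type) [Field K] [NumberField K] [Algebra F K] (hbox : UnanchoredBox K)
    (E₀ : WeierstrassCurve (𝓞 F)) (hΔ₀ : E₀.Δ ≠ 0) : IsModularEllipticCurve K (E₀.baseChange (𝓞 K)) :=
  (modularE_iff_box.1 h) K hbox _ (baseChange_Δ_ne_zero F K E₀ hΔ₀)

end Summit.Langlands.Langlands.Theorems.JDegreeFilterSplit
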